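import Summits.ABC.ABC.Theses.CubicResolventAllowance
import Literature.NumberTheory.NumberFields.CubicFieldExplicit
import Literature.NumberTheory.NumberFields.IntegralBasisCriterion
import Literature.NumberTheory.EllipticCurves.SzpiroOfAbcProofs
import Literature.NumberTheory.DiophantineGeometry.MinimalDiscriminantNormProofs

/-!
# Stub ideation k=2 (RESHAPE) for `stub_complexCubic` of crux `IndexSzpiro` (stmt-ABC-22740)

Elaboration sanity of the PROPOSED HELPER LEMMAS (statements only; `sorry` bodies) and of the
assembly `helpers ⇒ stub` (real proof).  Namespace is scratch; nothing here is a tree proposal.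

Spine (K-elimination): for a global minimal integral model `W₀` of `W` and `θ₀ = 4u⁻²(θ - r)`,
`θ₀` is a root of the monic integer cubic `X³ + b₂X² + 8b₄X + 16b₆` whose discriminant is
`2⁸·Δ(W₀) = 2⁸·(±Δ_min)`, and `disc(1,θ₀,θ₀²) = indexDet² · d_K`.  Hence
`2⁸ Δ_min^± = indexDet² · d_K`:  (i) `sign d_K = sign Δ(W)`;  (ii) the squarefree kernel of
`Δ_min` divides `d_K`.  The stub is then implied by "Szpiro `6+ε` for the SQUARE PART of `Δ_min`"
on the class `{f_W irreducible, Δ < 0}` — the allowance `|d_K|` pays exactly for the squarefree kernel.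
-/

open Polynomial

namespace Summit.ABC.ABC.Cruxes.IndexSzpiro.StubIdeas2

open Literature.NumberTheory.NumberFields

/-- The target stub, verbatim (for the composition check only). -/
def StubComplexCubic : Prop :=
  ∀ ε : ℝ, 0 < ε → ∃ C : ℝ, ∀ (W : WeierstrassCurve ℚ) [W.IsElliptic] (K : Type) [Field K]
    [NumberField K], Irreducible W.twoTorsionPolynomial.toPoly → Module.finrank ℚ K = 3 →
    (∃ θ : K, aeval θ W.twoTorsionPolynomial.toPoly = 0) → NumberField.discr K < 0 →
    (W.minimalDiscriminantNorm ℤ : ℝ) ≤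
      C * |(NumberField.discr K : ℝ)| * (W.conductorNorm ℤ : ℝ) ^ (6 + ε)

/-! ## H0 — the index-square identity and its ingredients (all S/M, tree glue) -/

/-- **H0a (root transport, S).** `ψ_{C • W}(x') = u⁻⁶ ψ_W(u²x' + r)`, so `u⁻²(θ - r)` is a root of
the transformed 2-division cubic.  Pattern: `WeierstrassCurve.eval_twoTorsionPolynomial_variableChange`
(RealPeriod.lean, over `ℝ`) — same `simp [variableChange_b₂, _b₄, _b₆]; field_simp; ring`. -/
theorem H0a_root_transport (W : WeierstrassCurve ℚ) (K : Type) [Field K] [NumberField K]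
    (C : WeierstrassCurve.VariableChange ℚ) (θ : K)
    (hθ : aeval θ W.twoTorsionPolynomial.toPoly = 0) :
    aeval (algebraMap ℚ K ((C.u⁻¹ : ℚˣ) : ℚ) ^ 2 * (θ - algebraMap ℚ K C.r))
      (C • W).twoTorsionPolynomial.toPoly = 0 := by
  sorry

/-- **H0b (monic rescaling, S).** For an integral model `W₀`, `4θ'` is a root of the MONIC integer
cubic `X³ + b₂X² + 8b₄X + 16b₆` (`= 16·ψ_{W₀}(X/4)`), and its discriminant is `2⁸ Δ(W₀)`
(`ring` after `WeierstrassCurve.b_relation`; cf. Mathlib `twoTorsionPolynomial_discr : disc ψ = 16Δ`). -/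
theorem H0b_monic_rescaling (W₀ : WeierstrassCurve ℤ) (K : Type) [Field K] [NumberField K] (θ' : K)
    (hθ : aeval θ' (W₀.baseChange ℚ).twoTorsionPolynomial.toPoly = 0) :
    aeval ((4 : K) * θ') (MonicCubic.poly W₀.b₂ (8 * W₀.b₄) (16 * W₀.b₆)) = 0 ∧
      MonicCubic.disc W₀.b₂ (8 * W₀.b₄) (16 * W₀.b₆) = 2 ^ 8 * W₀.Δ := by
  -- VERIFIED here (sorry-free): both are polynomial identities.
  refine ⟨?_, ?_⟩
  · have h16 : aeval ((4 : K) * θ') (MonicCubic.poly W₀.b₂ (8 * W₀.b₄) (16 * W₀.b₆)) =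
        16 * aeval θ' (W₀.baseChange ℚ).twoTorsionPolynomial.toPoly := by
      simp [MonicCubic.poly, WeierstrassCurve.twoTorsionPolynomial, Cubic.toPoly,
        WeierstrassCurve.baseChange, WeierstrassCurve.map_b₂, WeierstrassCurve.map_b₄,
        WeierstrassCurve.map_b₆, map_ofNat]
      ring
    rw [h16, hθ, mul_zero]
  · simp only [MonicCubic.disc, WeierstrassCurve.Δ, WeierstrassCurve.b₂, WeierstrassCurve.b₄,
      WeierstrassCurve.b₆, WeierstrassCurve.b₈]
    ring

/-- **H0c (irreducibility transport, S).** The monic model cubic is irreducible over `ℚ` when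
`ψ_W` is (affine substitution + unit scaling; or: `minpoly` of the transported root has degree
`3 = [K:ℚ]`, `MonicCubic.minpoly_rat_eq` pattern). -/
theorem H0c_irreducible_transport (W : WeierstrassCurve ℚ) (C : WeierstrassCurve.VariableChange ℚ)
    (W₀ : WeierstrassCurve ℤ) (hC : C • W = W₀.baseChange ℚ)
    (hirr : Irreducible W.twoTorsionPolynomial.toPoly) :
    Irreducible (MonicCubic.polyQ W₀.b₂ (8 * W₀.b₄) (16 * W₀.b₆)) := by
  sorry

/-- **H0 (index-square identity, M).** Signed: `2⁸·Δ(W) = u¹²·z²·d_K` for some `z ∈ ℤ∖0`, `u ∈ ℚˣ`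
(z = `indexDet` of the power basis of `θ₀`; tree: `exists_baseChange_int_forall_isMinimalAt`,
`MonicCubic.pb/discr_pb/isIntegral_pb_gen`, `discr_powerBasis_eq_indexDet_sq_mul_discr`,
`indexDet_ne_zero`, Mathlib `variableChange_Δ`); unsigned on `Δ_min`:
`2⁸·Δ_min = z²·|d_K|` (`minimalDiscriminantNorm_eq_natAbs_holds`, `minimalDiscriminantNorm_smul_rat`). -/
theorem H0_index_square (W : WeierstrassCurve ℚ) [W.IsElliptic] (K : Type) [Field K] [NumberField K]
    (hirr : Irreducible W.twoTorsionPolynomial.toPoly) (h3 : Module.finrank ℚ K = 3)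
    (hθ : ∃ θ : K, aeval θ W.twoTorsionPolynomial.toPoly = 0) :
    (∃ (z : ℤ) (u : ℚ), z ≠ 0 ∧ u ≠ 0 ∧
        (2 : ℚ) ^ 8 * W.Δ = u ^ 12 * (z : ℚ) ^ 2 * (NumberField.discr K : ℚ)) ∧
      ∃ z : ℤ, z ≠ 0 ∧
        (2 : ℤ) ^ 8 * (W.minimalDiscriminantNorm ℤ : ℤ) = z ^ 2 * |NumberField.discr K| := by
  sorry

/-! ## H1, H2 — the two consequences the assembly consumes -/

/-- **H1 (sign dictionary, S from H0).** On the stub's class, `d_K < 0 ↔ Δ(W) < 0`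
(`2⁸Δ = u¹² z² d_K` with `u¹²z² > 0`).  Alternative route: Mathlib `NumberField.sign_discr` +
tree `nrRealPlaces_eq_one_of_cubic_discr_neg` / `isTotallyReal_iff_cubic_discr_pos`. -/
def SignDictionary : Prop :=
  ∀ (W : WeierstrassCurve ℚ) [W.IsElliptic] (K : Type) [Field K] [NumberField K],
    Irreducible W.twoTorsionPolynomial.toPoly → Module.finrank ℚ K = 3 →
    (∃ θ : K, aeval θ W.twoTorsionPolynomial.toPoly = 0) → (NumberField.discr K < 0 ↔ W.Δ < 0)

theorem H1_sign : SignDictionary := by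
  sorry

/-- **H2 (squarefree kernel divides `d_K`, M from H0).** If `Δ_min = b²·a` with `a` squarefree then
`a ∣ d_K`: for `p ∣ a`, `v_p(2⁸ b² a)` is odd, so `v_p(z² |d_K|)` is odd, so `p ∣ d_K`. -/
def KernelDividesDisc : Prop :=
  ∀ (W : WeierstrassCurve ℚ) [W.IsElliptic] (K : Type) [Field K] [NumberField K],
    Irreducible W.twoTorsionPolynomial.toPoly → Module.finrank ℚ K = 3 →
    (∃ θ : K, aeval θ W.twoTorsionPolynomial.toPoly = 0) →
    ∀ a b : ℕ, W.minimalDiscriminantNorm ℤ = b ^ 2 * a → Squarefree a → (a : ℤ) ∣ NumberField.discr K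

theorem H2_kernel_dvd : KernelDividesDisc := by
  sorry

/-! ## The K-free kernel (OPEN — this is where the difficulty lives) -/

/-- **Kernel (open, Szpiro-strength on its class).** Szpiro `6+ε` for the SQUARE PART of the minimal
discriminant, on curves with irreducible 2-division cubic and `Δ < 0`; no number field in sight. -/
def SquarePartSzpiroNeg : Prop :=
  ∀ ε : ℝ, 0 < ε → ∃ C : ℝ, ∀ (W : WeierstrassCurve ℚ) [W.IsElliptic],
    Irreducible W.twoTorsionPolynomial.toPoly → W.Δ < 0 →
    ∀ a b : ℕ, W.minimalDiscriminantNorm ℤ = b ^ 2 * a → Squarefree a →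
    ((b : ℝ) ^ 2 ≤ C * (W.conductorNorm ℤ : ℝ) ^ (6 + ε))

/-! ## Assembly: kernel + H1 + H2 ⇒ stub (real proof) -/

theorem stub_of_kernel (hK : SquarePartSzpiroNeg) (h1 : SignDictionary) (h2 : KernelDividesDisc) :
    StubComplexCubic := by
  intro ε hε
  obtain ⟨C, hC⟩ := hK ε hε
  refine ⟨max C 0, ?_⟩
  intro W _ K _ _ hirr h3 hθ hdK
  have hΔ : W.Δ < 0 := (h1 W K hirr h3 hθ).mp hdK
  obtain ⟨a, b, hab, hsq⟩ := Nat.sq_mul_squarefree (W.minimalDiscriminantNorm ℤ)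
  have hb : ((b : ℝ) ^ 2 ≤ C * (W.conductorNorm ℤ : ℝ) ^ (6 + ε)) := hC W hirr hΔ a b hab.symm hsq
  have hN0 : (0 : ℝ) ≤ (W.conductorNorm ℤ : ℝ) ^ (6 + ε) :=
    Real.rpow_nonneg (Nat.cast_nonneg _) _
  have hb' : (b : ℝ) ^ 2 ≤ max C 0 * (W.conductorNorm ℤ : ℝ) ^ (6 + ε) :=
    hb.trans (mul_le_mul_of_nonneg_right (le_max_left C 0) hN0)
  have hdvd : (a : ℤ) ∣ NumberField.discr K := h2 W K hirr h3 hθ a b hab.symm hsq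
  have hd0 : NumberField.discr K ≠ 0 := NumberField.discr_ne_zero K
  have ha : (a : ℤ) ≤ |NumberField.discr K| :=
    Int.le_of_dvd (abs_pos.mpr hd0) ((dvd_abs _ _).mpr hdvd)
  have ha' : (a : ℝ) ≤ |(NumberField.discr K : ℝ)| := by
    have := (Int.cast_le (R := ℝ)).mpr ha
    simpa [Int.cast_abs] using this
  have hcast : (W.minimalDiscriminantNorm ℤ : ℝ) = (b : ℝ) ^ 2 * (a : ℝ) := by
    rw [← hab]; push_cast; ring
  rw [hcast]
  calc (b : ℝ) ^ 2 * (a : ℝ)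
      ≤ (max C 0 * (W.conductorNorm ℤ : ℝ) ^ (6 + ε)) * |(NumberField.discr K : ℝ)| :=
        mul_le_mul hb' ha' (Nat.cast_nonneg a) (mul_nonneg (le_max_right C 0) hN0)
    _ = max C 0 * |(NumberField.discr K : ℝ)| * (W.conductorNorm ℤ : ℝ) ^ (6 + ε) := by ring

/-- Sanity: `StubComplexCubic` is literally the registered stub signature (up to `Polynomial.` prefix). -/
example : StubComplexCubic ↔
    (∀ ε : ℝ, 0 < ε → ∃ C : ℝ, ∀ (W : WeierstrassCurve ℚ) [W.IsElliptic] (K : Type) [Field K]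
      [NumberField K], Irreducible W.twoTorsionPolynomial.toPoly → Module.finrank ℚ K = 3 →
      (∃ θ : K, Polynomial.aeval θ W.twoTorsionPolynomial.toPoly = 0) → NumberField.discr K < 0 →
      (W.minimalDiscriminantNorm ℤ : ℝ) ≤
        C * |(NumberField.discr K : ℝ)| * (W.conductorNorm ℤ : ℝ) ^ (6 + ε)) := Iff.rfl

/-! ## Sandwich (informational): stub ⇒ kernel with exponent `7+ε`
(`|d_K| ≤ 1944·N²` is route item `ResolventDiscBounds`; sharper: `|d_K|/a ≤ c·∏_{p additive} p² ≤ c·N`). -/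
def SquarePartSzpiroNeg7 : Prop :=
  ∀ ε : ℝ, 0 < ε → ∃ C : ℝ, ∀ (W : WeierstrassCurve ℚ) [W.IsElliptic],
    Irreducible W.twoTorsionPolynomial.toPoly → W.Δ < 0 →
    ∀ a b : ℕ, W.minimalDiscriminantNorm ℤ = b ^ 2 * a → Squarefree a →
    ((b : ℝ) ^ 2 ≤ C * (W.conductorNorm ℤ : ℝ) ^ (7 + ε))

/-- Upper end of the sandwich (VERIFIED): Szpiro `6+ε` (tree conjecture decl
`Literature.NumberTheory.EllipticCurves.SzpiroConjecture`) ⇒ kernel, since `b² ≤ b²a = Δ_min`. -/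
theorem kernel_of_szpiro (h : Literature.NumberTheory.EllipticCurves.SzpiroConjecture) :
    SquarePartSzpiroNeg := by
  intro ε hε
  obtain ⟨C, hC⟩ := h ε hε
  refine ⟨C, ?_⟩
  intro W _ _ _ a b hab hsq
  have ha : 1 ≤ a := Nat.one_le_iff_ne_zero.mpr hsq.ne_zero
  have hle : (b : ℝ) ^ 2 ≤ (W.minimalDiscriminantNorm ℤ : ℝ) := by
    rw [hab]; push_cast
    have hb0 : (0 : ℝ) ≤ (b : ℝ) ^ 2 := by positivity
    have ha' : (1 : ℝ) ≤ (a : ℝ) := by exact_mod_cast ha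
    nlinarith
  exact hle.trans (hC W)

/-! ## Plan B lemma statements (structural meaning of the sign: odd `S₃` Artin representation) -/

/-- **B1 (S).** A negative field discriminant is not a square. -/
theorem B1_not_isSquare_of_neg (K : Type) [Field K] [NumberField K] (h : NumberField.discr K < 0) :
    ¬ IsSquare (NumberField.discr K) := by
  sorry

/-- **B2 (M).** `Δ(W) < 0` + irreducible ⇒ the 2-division field has Galois group all of `S₃`
acting on the three roots (Mathlib `Polynomial.Gal.galActionHom_bijective_of_prime_degree`,
the `Fact` binder is Mathlib's local instance `Polynomial.Gal.splits_ℚ_ℂ`: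
prime degree `3`, exactly one real root by `cubic_card_roots_le_one_of_discr_neg`). -/
theorem B2_gal_full (W : WeierstrassCurve ℚ) [W.IsElliptic]
    [Fact ((W.twoTorsionPolynomial.toPoly.map (algebraMap ℚ ℂ)).Splits)]
    (hirr : Irreducible W.twoTorsionPolynomial.toPoly) (hΔ : W.Δ < 0) :
    Function.Bijective (Polynomial.Gal.galActionHom W.twoTorsionPolynomial.toPoly ℂ) := by
  sorry

end Summit.ABC.ABC.Cruxes.IndexSzpiro.StubIdeas2
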